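import Summits.CriticalPhenomena.CardyFormulaZ2.Theses.CardyWhiteToColoured
import Summits.CriticalPhenomena.CardyFormulaZ2.Theorems.CardyTensorRGPolyominoToJordan
import Summits.CriticalPhenomena.CardyFormulaZ2.Theorems.CardyWhiteToColouredSimilarityUpgradeRectangleContinuity
import Summits.CriticalPhenomena.CardyFormulaZ2.Theorems.CardyWhiteToColouredSimilarityUpgradeStubRectangleFamily
import Literature.Probability.RandomPlanarGeometry.RectangleModulusAspectRatio

/-!
# Stub `stub_polyominoHeartSuffices` (line `registered`, crux `SimilarityUpgrade`, stmt-CriticalPhenomena-4597)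

Crux `Summit.CriticalPhenomena.CardyFormulaZ2.Theses.CardyWhiteToColoured.SimilarityUpgrade`,
route `CardyWhiteToColoured`, sub-problem `CardyFormulaZ2`, line `registered`, groundwork stub
**G4** `stub_polyominoHeartSuffices`: the heart H3 restricted to POLYOMINO conformal rectangles
with lattice marks (interior of a finite union of closed `δ₀`-squares, marked points in
`δ₀ ℤ[i]`) versus corner-marked boxes `((0,w) × (0,1); i, 0, w, w + i)` of equal modulus already
implies the crux.

Proof.  Given the crux hypothesis `⟨Φ, hlim, hsim⟩` (full, similarity-invariant bond-ℤ² crossing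
limits):
1. (`polyominoHeart_exists_modulusFn`, the construction of `stub_modulusGlue`.)  Let `η` be the
   modulus function of `rectangle_crossRatio_eq_of_aspectRatio_holds` (strictly antitone from
   `(0,∞)` onto `(0,1)`) and `Qc w` the corner-marked box family of c1
   (`RectangleFamily.exists_shift3` of `rectQuad 0 w 0 1`; carrier `(0,w) × (0,1)`, arcs `0/2` the
   left/right sides, marks `i, 0, w, w + i`: `RectangleFamily.lr_family`, `RectangleFamily.lr_pt`).
   Every uniformizing datum of `Qc w` has cross-ratio `η w`.  Put `f t := Φ (Qc (η⁻¹ t))` with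
   `η⁻¹` a chosen right inverse of `η` on `(0,1)`.  `f` is continuous on `(0,1)`: `w ↦ Φ (Qc w)`
   is continuous on `(0,∞)` by H1 (`rectangleContinuity`, landed) and `η⁻¹` maps the interval
   `(η (w₀+ρ), η (w₀-ρ))` into `(w₀-ρ, w₀+ρ)` by strict antitonicity.
2. For a polyomino `R` with datum `(φ, x)`, `t := crossRatio x ∈ (0,1)`; the box `Qc (η⁻¹ t)`
   with any datum (`MarkedDomain.exists_isUniformizing_holds`) has cross-ratio `t`, so the
   polyomino heart gives `Φ R = Φ (Qc (η⁻¹ t)) = f t`, and the full limit `hlim R` is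
   `R.HasCrossingLimit (bondDomainCrossingProb R) f`.
3. `PolyominoToJordan_proof f` (crux stmt-CriticalPhenomena-14338 of route `CardyTensorRG`,
   closed: crossing-limit laws `F(modulus)` with `F` continuous on `(0,1)` extend from polyomino
   quads to all conformal rectangles) gives `R.HasCrossingLimit (bondDomainCrossingProb R) f` for
   every conformal rectangle `R`, the conclusion of the crux.
No definitions are introduced.

References: B. Bollobás, O. Riordan, *Percolation* (2006), Ch. 7 §7.1 p. 184 (the modulus of a
rectangle is a strictly decreasing function of the aspect ratio), Ch. 7 Lemma 14 (polyomino /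
Jordan approximation); O. Schramm, S. Smirnov, Ann. Probab. 39 (2011), §6.
-/

noncomputable section

namespace Summit.CriticalPhenomena.CardyFormulaZ2.Cruxes.SimilarityUpgrade.Stubs

open Filter Topology Set MeasureTheory
open Literature.Probability.RandomPlanarGeometry
open Literature.Probability.Percolation

/-- **The modulus function of a full-limit `Φ` along the corner-marked box family** (the
construction of `stub_modulusGlue`, with the landed H1 `rectangleContinuity` plugged in): if the
bond-ℤ² crossing probability of every conformal rectangle converges (to `Φ`), there are a family
`Qc w` (`w > 0`) of corner-marked boxes `((0,w) × (0,1); i, 0, w, w + i)` with arcs `0/2` the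
left/right sides and a function `f` continuous on `(0,1)` such that every `t ∈ (0,1)` is the
modulus of some `Qc w` with `f t = Φ (Qc w)`.  Here `f := Φ ∘ Qc ∘ η⁻¹` for the strictly
antitone modulus function `η` of `rectangle_crossRatio_eq_of_aspectRatio_holds`; continuity from
that of `w ↦ Φ (Qc w)` (H1) and strict antitonicity of `η`.
[cite: BollobasRiordan2006, Ch. 7 §7.1 p. 184] -/
theorem polyominoHeart_exists_modulusFn (Φ : ConformalRectangle → ℝ)
    (hlim : ∀ R : ConformalRectangle, Tendsto (bondDomainCrossingProb R) (𝓝[>] (0 : ℝ)) (𝓝 (Φ R))) :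
    ∃ (Qc : ℝ → ConformalRectangle) (f : ℝ → ℝ), ContinuousOn f (Ioo 0 1) ∧
      (∀ w : ℝ, 0 < w → (Qc w).carrier = (Ioo (0 : ℝ) w ×ℂ Ioo (0 : ℝ) 1) ∧
        (Qc w).arc 0 = {z : ℂ | z.re = 0 ∧ z.im ∈ Icc (0 : ℝ) 1} ∧
        (Qc w).arc 2 = {z : ℂ | z.re = w ∧ z.im ∈ Icc (0 : ℝ) 1} ∧
        (Qc w).pt 0 = Complex.I ∧ (Qc w).pt 1 = 0 ∧ (Qc w).pt 2 = (w : ℂ) ∧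
        (Qc w).pt 3 = (w : ℂ) + Complex.I) ∧
      ∀ t ∈ Ioo (0 : ℝ) 1, ∃ w : ℝ, 0 < w ∧ f t = Φ (Qc w) ∧
        ∀ (ψ : ConformalEquiv UpperHalfPlane.upperHalfPlaneSet (Qc w).carrier) (y : Fin 4 → ℝ),
          (Qc w).IsUniformizing ψ y → crossRatio y = t := by
  -- adapted from `stub_modulusGlue` (CardyWhiteToColouredSimilarityUpgradeStubModulusGlue.lean)
  -- the corner-marked box family `w ↦ sh (Q' w)` (c1, `stub_rectangleFamily`)
  choose sh hsh using RectangleFamily.exists_shift3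
  obtain ⟨Q', hQ'⟩ : ∃ Q' : ℝ → ConformalRectangle,
      ∀ (w : ℝ) (hw : 0 < w), Q' w = rectQuad 0 w 0 1 hw one_pos :=
    ⟨fun w => if h : 0 < w then rectQuad 0 w 0 1 h one_pos else rectQuad 0 1 0 1 one_pos one_pos,
      fun w hw => dif_pos hw⟩
  have hfam := RectangleFamily.lr_family sh hsh Q' hQ'
  have hpt := RectangleFamily.lr_pt sh hsh Q' hQ'
  -- the modulus function of rectangles
  obtain ⟨η, hanti, himage, hmod⟩ := rectangle_crossRatio_eq_of_aspectRatio_holds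
  have hQmod : ∀ w : ℝ, 0 < w →
      ∀ (ψ : ConformalEquiv UpperHalfPlane.upperHalfPlaneSet (sh (Q' w)).carrier) (y : Fin 4 → ℝ),
        (sh (Q' w)).IsUniformizing ψ y → crossRatio y = η w := by
    intro w hw ψ y hψ
    obtain ⟨p0, p1, p2, p3⟩ := hpt w hw
    obtain ⟨hcar, -, -⟩ := hfam w hw
    have key := hmod (sh (Q' w)) w 1 hw one_pos hcar
      ⟨by rw [p0]; simp, p1, p2, by rw [p3]; simp⟩ ψ y hψ
    rwa [div_one] at key
  -- a right inverse of `η` on `(0,1)`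
  have hex : ∀ t : ℝ, t ∈ Ioo (0 : ℝ) 1 → ∃ w : ℝ, w ∈ Ioi (0 : ℝ) ∧ η w = t := by
    intro t ht
    rw [← himage] at ht
    exact ht
  choose! winv hwinv_pos hη_winv using hex
  refine ⟨fun w => sh (Q' w), fun t => Φ (sh (Q' (winv t))), ?_, fun w hw => ?_, fun t ht => ?_⟩
  · -- continuity of `f` on `(0,1)`
    have hg : ContinuousOn (fun w => Φ (sh (Q' w))) (Ioi 0) :=
      rectangleContinuity Φ hlim (fun w => sh (Q' w)) hfam
    intro t₀ ht₀
    have hw₀ : 0 < winv t₀ := hwinv_pos t₀ ht₀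
    have hgat : ContinuousAt (fun w => Φ (sh (Q' w))) (winv t₀) :=
      hg.continuousAt (Ioi_mem_nhds hw₀)
    rw [Metric.continuousWithinAt_iff]
    intro e he
    obtain ⟨ρ, hρ, hρ'⟩ := Metric.continuousAt_iff.1 hgat e he
    set w₀ : ℝ := winv t₀ with hw₀def
    have hηw₀ : η w₀ = t₀ := hη_winv t₀ ht₀
    set ρ₁ : ℝ := min (ρ / 2) (w₀ / 2) with hρ₁
    have hρ₁pos : 0 < ρ₁ := lt_min (by linarith) (by linarith)
    have hρ₁le : ρ₁ ≤ ρ / 2 := min_le_left _ _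
    have hρ₁le' : ρ₁ ≤ w₀ / 2 := min_le_right _ _
    have hu₁ : 0 < w₀ - ρ₁ := by linarith
    have hu₂ : 0 < w₀ + ρ₁ := by linarith
    have hlt₁ : η (w₀ + ρ₁) < t₀ := by
      rw [← hηw₀]
      exact hanti (mem_Ioi.2 hw₀) (mem_Ioi.2 hu₂) (by linarith)
    have hlt₂ : t₀ < η (w₀ - ρ₁) := by
      rw [← hηw₀]
      exact hanti (mem_Ioi.2 hu₁) (mem_Ioi.2 hw₀) (by linarith)
    refine ⟨min (t₀ - η (w₀ + ρ₁)) (η (w₀ - ρ₁) - t₀), lt_min (by linarith) (by linarith),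
      fun t ht hdist => ?_⟩
    have hw : 0 < winv t := hwinv_pos t ht
    have hηw : η (winv t) = t := hη_winv t ht
    rw [Real.dist_eq, abs_lt] at hdist
    have hm₁ := min_le_left (t₀ - η (w₀ + ρ₁)) (η (w₀ - ρ₁) - t₀)
    have hm₂ := min_le_right (t₀ - η (w₀ + ρ₁)) (η (w₀ - ρ₁) - t₀)
    have h₁ : η (w₀ + ρ₁) < η (winv t) := by
      rw [hηw]
      linarith [hdist.1]
    have h₂ : η (winv t) < η (w₀ - ρ₁) := by
      rw [hηw]
      linarith [hdist.2]
    have h₃ : winv t < w₀ + ρ₁ := (hanti.lt_iff_gt (mem_Ioi.2 hu₂) (mem_Ioi.2 hw)).1 h₁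
    have h₄ : w₀ - ρ₁ < winv t := (hanti.lt_iff_gt (mem_Ioi.2 hw) (mem_Ioi.2 hu₁)).1 h₂
    apply hρ'
    rw [Real.dist_eq, abs_lt]
    constructor <;> linarith
  · -- carrier, arcs and marked points of the corner-marked boxes
    obtain ⟨hcar, ha0, ha2⟩ := hfam w hw
    obtain ⟨p0, p1, p2, p3⟩ := hpt w hw
    exact ⟨hcar, ha0, ha2, p0, p1, p2, p3⟩
  · -- every `t ∈ (0,1)` is the modulus of the box `Qc (η⁻¹ t)`, where `f t = Φ (Qc (η⁻¹ t))`
    exact ⟨winv t, hwinv_pos t ht, rfl, fun ψ y hψ => by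
      rw [hQmod _ (hwinv_pos t ht) ψ y hψ, hη_winv t ht]⟩

/-- **stub_polyominoHeartSuffices (G4).** The heart H3 on POLYOMINO conformal rectangles with
lattice marks already gives the crux `SimilarityUpgrade`: given full, similarity-invariant
bond-ℤ² crossing limits `Φ`, take the modulus function `f := Φ ∘ Qc ∘ η⁻¹` of
`polyominoHeart_exists_modulusFn` (continuous on `(0,1)` by H1 `rectangleContinuity` and the
strictly antitone rectangle modulus `rectangle_crossRatio_eq_of_aspectRatio_holds`); for a
polyomino `R` with datum `(φ, x)` the corner-marked box `Qc (η⁻¹ (crossRatio x))` has the same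
modulus, so the polyomino heart gives `Φ R = f (crossRatio x)`, i.e. every polyomino quad has
crossing limit `f (modulus)`; the closed crux `PolyominoToJordan` of route `CardyTensorRG`
(`PolyominoToJordan_proof`: polyomino sandwiches + Radó + continuity of `f`) extends this to every
conformal rectangle. [cite: BollobasRiordan2006, Ch. 7 §7.1 p. 184 and Lemma 14] -/
theorem stub_polyominoHeartSuffices :
    (∀ Φ : ConformalRectangle → ℝ,
      (∀ R : ConformalRectangle, Tendsto (bondDomainCrossingProb R) (𝓝[>] (0 : ℝ)) (𝓝 (Φ R))) →
      (∀ (R R' : ConformalRectangle) (a w : ℂ), a ≠ 0 →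
        R'.carrier = (fun z : ℂ => a * z + w) '' R.carrier →
        R'.arc 0 = (fun z : ℂ => a * z + w) '' R.arc 0 →
        R'.arc 2 = (fun z : ℂ => a * z + w) '' R.arc 2 → Φ R' = Φ R) →
      ∀ (R R' : ConformalRectangle),
        (∃ δ₀ : ℝ, 0 < δ₀ ∧ (∃ s : Finset (ℤ × ℤ), R.carrier = interior (⋃ p ∈ s,
            {z : ℂ | δ₀ * (p.1 : ℝ) ≤ z.re ∧ z.re ≤ δ₀ * ((p.1 : ℝ) + 1) ∧
              δ₀ * (p.2 : ℝ) ≤ z.im ∧ z.im ≤ δ₀ * ((p.2 : ℝ) + 1)})) ∧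
          ∀ i, ∃ m n : ℤ, R.pt i = (δ₀ : ℂ) * ((m : ℂ) + (n : ℂ) * Complex.I)) →
        (∃ w : ℝ, 0 < w ∧ R'.carrier = (Ioo (0 : ℝ) w ×ℂ Ioo (0 : ℝ) 1) ∧
          R'.arc 0 = {z : ℂ | z.re = 0 ∧ z.im ∈ Icc (0 : ℝ) 1} ∧
          R'.arc 2 = {z : ℂ | z.re = w ∧ z.im ∈ Icc (0 : ℝ) 1} ∧
          R'.pt 0 = Complex.I ∧ R'.pt 1 = 0 ∧ R'.pt 2 = (w : ℂ) ∧ R'.pt 3 = (w : ℂ) + Complex.I) →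
        ∀ (φ : ConformalEquiv UpperHalfPlane.upperHalfPlaneSet R.carrier) (x : Fin 4 → ℝ)
          (φ' : ConformalEquiv UpperHalfPlane.upperHalfPlaneSet R'.carrier) (x' : Fin 4 → ℝ),
          R.IsUniformizing φ x → R'.IsUniformizing φ' x' → crossRatio x = crossRatio x' →
          Φ R = Φ R') →
    Summit.CriticalPhenomena.CardyFormulaZ2.Theses.CardyWhiteToColoured.SimilarityUpgrade := by
  intro hPoly
  rintro ⟨Φ, hlim, hsim⟩
  obtain ⟨Qc, f, hf, hQc, hval⟩ := polyominoHeart_exists_modulusFn Φ hlim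
  -- every polyomino quad has crossing limit `f (modulus)`, by the polyomino heart
  have hpoly : ∀ R : ConformalRectangle,
      (∃ δ₀ : ℝ, 0 < δ₀ ∧ (∃ s : Finset (ℤ × ℤ), R.carrier = interior (⋃ p ∈ s,
          {z : ℂ | δ₀ * (p.1 : ℝ) ≤ z.re ∧ z.re ≤ δ₀ * ((p.1 : ℝ) + 1) ∧
            δ₀ * (p.2 : ℝ) ≤ z.im ∧ z.im ≤ δ₀ * ((p.2 : ℝ) + 1)})) ∧
        ∀ i, ∃ m n : ℤ, R.pt i = (δ₀ : ℂ) * ((m : ℂ) + (n : ℂ) * Complex.I)) →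
      R.HasCrossingLimit (bondDomainCrossingProb R) f := by
    intro R hR φ x hφ
    have ht : crossRatio x ∈ Ioo (0 : ℝ) 1 :=
      ConformalRectangle.crossRatio_mem_Ioo_of_isUniformizing hφ
    obtain ⟨w, hw, hfw, hmod⟩ := hval _ ht
    obtain ⟨ψ, y, hψ⟩ := MarkedDomain.exists_isUniformizing_holds (Qc w)
    obtain ⟨hcar, ha0, ha2, p0, p1, p2, p3⟩ := hQc w hw
    have hRQ : Φ R = Φ (Qc w) :=
      hPoly Φ hlim hsim R (Qc w) hR ⟨w, hw, hcar, ha0, ha2, p0, p1, p2, p3⟩ φ x ψ y hφ hψ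
        (hmod ψ y hψ).symm
    rw [hfw, ← hRQ]
    exact hlim R
  -- the closed crux `PolyominoToJordan` extends the law to every conformal rectangle
  exact ⟨f, Cruxes.PolyominoToJordan.Birth.PolyominoToJordan_proof f hf hpoly⟩

end Summit.CriticalPhenomena.CardyFormulaZ2.Cruxes.SimilarityUpgrade.Stubs

end
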